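import Summits.HubbardSuperconductivity.HubbardSuperconductivity.Theorems.AnisotropyChordStiffnessDiamagnetic

/-!
# Route `AnisotropyChord` / H0 rotor rung: THE LATTICE f-SUM RULE (stub T-FSUM of THEOREM TWIST-IR, theory seat
# memo ROTOR-THEORY-8 §118), PROVED for `L ≥ 3`

For the hard-core boson / XXZ torus `(ℤ/L)²`, `L ≥ 3`, a real eigen-amplitude `ψ` (`Hψ = Eψ`), the eigenbasis
`(vᵢ, λᵢ)` of `H` and a grid momentum `k`:

  `Σᵢ |⟨vᵢ, D_k ψ⟩|²/(λᵢ − E) = Σ_j (1 − cos(2πk_j/L)) ⟨ψ, (−T_j) ψ⟩`,   `D_k = [H, ρ_k]`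

(`latticeFSum_eq`).  Proof: `⟨vᵢ, D_kψ⟩ = (λᵢ − E)⟨vᵢ, ρ_kψ⟩`, so the left side is `Re⟨ρ_kψ, (H − E)ρ_kψ⟩`
(`spectral_fsum`); the ground-state transform (`xxz_groundStateTransform`, p601907) with `u = ρ_k` (the density
mode) turns it into `Σ_edges ¼ Σ_flip ψψ' |ρ_k(σ) − ρ_k(σ')|²`; across the bond `{x, x+e_j}` a hop changes the
density mode by `φ_k(x) − φ_k(x+e_j)`, of squared modulus `2(1 − cos(2πk_j/L))`; and for `L ≥ 3` the directed bonds
`(x, j)` enumerate the edges exactly once (`bond_injective` + surjectivity), giving `Σ_j (1−cos) Σ_x ⟨ψ,K_{x,x+e_j}ψ⟩`.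
-/

set_option linter.dupNamespace false

noncomputable section

open Matrix Complex Finset
open scoped ComplexConjugate
open Literature.MathematicalPhysics.QuantumLattice hiding torusPhase torusNorm
open Literature.Probability.LatticeModels
open Summit.HubbardSuperconductivity.HubbardSuperconductivity.Theorems.AnisotropyChord.InsertionEntropy
  (torusPhase norm_torusPhase torusPhase_add_right torusPhase_eq_torusChar densityMode_update_one
    densityMode_update_zero IsPerronSectorGroundAmplitude)

namespace Summit.HubbardSuperconductivity.HubbardSuperconductivity.Theorems.AnisotropyChord.Stiffness

/-! ## The spectral identity `Σᵢ |⟨vᵢ,(H−E)φ⟩|²/(λᵢ−E) = Re⟨φ,(H−E)φ⟩` -/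

section Spectral

variable {n : Type*} [Fintype n] [DecidableEq n]

/-- `⟨vᵢ, (H − E)φ⟩ = (λᵢ − E) ⟨vᵢ, φ⟩` for the eigenbasis of a Hermitian `H`. [folklore] -/
theorem eigenvectorBasis_dotProduct_shifted (H : Matrix n n ℂ) (hH : H.IsHermitian) (E : ℝ) (φ : n → ℂ) (i : n) :
    star (⇑(hH.eigenvectorBasis i)) ⬝ᵥ (H *ᵥ φ - (E : ℂ) • φ)
      = ((hH.eigenvalues i - E : ℝ) : ℂ) * (star (⇑(hH.eigenvectorBasis i)) ⬝ᵥ φ) := by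
  have h1 : star (⇑(hH.eigenvectorBasis i)) ⬝ᵥ (H *ᵥ φ)
      = ((hH.eigenvalues i : ℝ) : ℂ) * (star (⇑(hH.eigenvectorBasis i)) ⬝ᵥ φ) := by
    rw [dotProduct_mulVec]
    have h2 : star (H *ᵥ ⇑(hH.eigenvectorBasis i)) = star (⇑(hH.eigenvectorBasis i)) ᵥ* H := by
      rw [star_mulVec, hH.eq]
    have h3 : star (⇑(hH.eigenvectorBasis i)) ᵥ* H = ((hH.eigenvalues i : ℝ) : ℂ) • star (⇑(hH.eigenvectorBasis i)) := by
      rw [← h2, hH.mulVec_eigenvectorBasis i]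
      funext σ
      simp [Pi.smul_apply]
    rw [h3, smul_dotProduct, smul_eq_mul]
  rw [dotProduct_sub, dotProduct_smul, h1, smul_eq_mul]
  push_cast
  ring

/-- **Spectral form of the f-sum:** `Σᵢ |⟨vᵢ,(H−E)φ⟩|²/(λᵢ−E) = Re⟨φ, (H−E)φ⟩` (terms with `λᵢ = E` vanish on
both sides). [folklore] -/
theorem spectral_fsum (H : Matrix n n ℂ) (hH : H.IsHermitian) (E : ℝ) (φ : n → ℂ) :
    ∑ i, ‖star (⇑(hH.eigenvectorBasis i)) ⬝ᵥ (H *ᵥ φ - (E : ℂ) • φ)‖ ^ 2 / (hH.eigenvalues i - E)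
      = (star φ ⬝ᵥ (H *ᵥ φ - (E : ℂ) • φ)).re := by
  -- completeness: `⟨φ,w⟩ = Σᵢ ⟨φ,vᵢ⟩⟨vᵢ,w⟩`
  have hcomp := sum_dotProduct_mulVec_mul_dotProduct hH 1 φ (H *ᵥ φ - (E : ℂ) • φ)
  simp only [Matrix.one_mulVec] at hcomp
  rw [← hcomp, Complex.re_sum]
  refine Finset.sum_congr rfl fun i _ => ?_
  rw [eigenvectorBasis_dotProduct_shifted H hH E φ i, Matrix.star_dotProduct (⇑(hH.eigenvectorBasis i)) φ]
  set d := star φ ⬝ᵥ ⇑(hH.eigenvectorBasis i) with hd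
  have hcc : d * (((hH.eigenvalues i - E : ℝ) : ℂ) * star d)
      = (((hH.eigenvalues i - E) * ‖d‖ ^ 2 : ℝ) : ℂ) := by
    rw [show d * (((hH.eigenvalues i - E : ℝ) : ℂ) * star d) = ((hH.eigenvalues i - E : ℝ) : ℂ) * (d * star d) by
      ring]
    rw [show star d = conj d from rfl, Complex.mul_conj, Complex.normSq_eq_norm_sq]
    push_cast; ring
  rw [hcc, Complex.ofReal_re, norm_mul, Complex.norm_real, Real.norm_eq_abs, mul_pow, sq_abs, norm_star]
  by_cases h0 : hH.eigenvalues i - E = 0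
  · rw [h0]; simp
  · field_simp

end Spectral

/-! ## The density mode under a hop, and the phase across a bond -/

variable {L : ℕ} [NeZero L]

/-- Across a flippable bond the density mode changes by `φ_k(y) − φ_k(x)` (particle moved from `x` to `y`):
for `σ_x = 0`, `σ_y = 1`, `ρ_k(σ∘swap) = ρ_k(σ) − φ_k(x) + φ_k(y)`. [folklore] -/
theorem densityMode_comp_swap {x y : TorusSite 2 L} (hxy : x ≠ y) (σ : TensorIndex (TorusSite 2 L) 2)
    (hx : σ x = 0) (hy : σ y = 1) (k : TorusSite 2 L) :
    (∑ s, if (σ ∘ Equiv.swap x y) s = 0 then torusPhase L k s else 0)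
      = (∑ s, if σ s = 0 then torusPhase L k s else 0) - torusPhase L k x + torusPhase L k y := by
  rw [← update_update_eq_comp_swap hxy σ hx hy]
  have h1 : Function.update σ x 1 y = 1 := by rw [Function.update_of_ne (Ne.symm hxy)]; exact hy
  rw [densityMode_update_zero (Function.update σ x 1) y h1 k, densityMode_update_one σ x hx k]

/-- `|ρ_k(σ) − ρ_k(σ∘swap)|² = |φ_k(x) − φ_k(y)|²` on flippable configurations. [folklore] -/
theorem norm_densityMode_sub_comp_swap {x y : TorusSite 2 L} (hxy : x ≠ y) (σ : TensorIndex (TorusSite 2 L) 2)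
    (hflip : σ x ≠ σ y) (k : TorusSite 2 L) :
    ‖(∑ s, if σ s = 0 then torusPhase L k s else 0)
        - (∑ s, if (σ ∘ Equiv.swap x y) s = 0 then torusPhase L k s else 0)‖ ^ 2
      = ‖torusPhase L k x - torusPhase L k y‖ ^ 2 := by
  have fin2 : ∀ t : Fin 2, t = 0 ∨ t = 1 := by decide
  rcases fin2 (σ x) with hx | hx <;> rcases fin2 (σ y) with hy | hy
  · exact absurd (hx.trans hy.symm) hflip
  · rw [densityMode_comp_swap hxy σ hx hy k]; congr 1; ring
  · have h := densityMode_comp_swap (Ne.symm hxy) σ hy hx k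
    rw [Equiv.swap_comm] at h
    rw [h]
    have e : (∑ s, if σ s = 0 then torusPhase L k s else 0)
        - ((∑ s, if σ s = 0 then torusPhase L k s else 0) - torusPhase L k y + torusPhase L k x)
        = -(torusPhase L k x - torusPhase L k y) := by ring
    rw [e, norm_neg]
  · exact absurd (hx.trans hy.symm) hflip

/-- `φ_k(eⱼ) = e^{2πi kⱼ/L}` and `|φ_k(x) − φ_k(x+eⱼ)|² = 2(1 − cos(2π kⱼ/L))`. [folklore] -/
theorem norm_torusPhase_sub_sq (hL : 2 ≤ L) (k x : TorusSite 2 L) (j : Fin 2) :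
    ‖torusPhase L k x - torusPhase L k (x + Pi.single j 1)‖ ^ 2
      = 2 * (1 - Real.cos (2 * Real.pi * ((k j).val : ℝ) / (L : ℝ))) := by
  haveI : Fact (1 < L) := ⟨by omega⟩
  -- the phase of the unit step
  have hstep : torusPhase L k (Pi.single j 1) = cexp (((2 * Real.pi * ((k j).val : ℝ) / (L : ℝ) : ℝ) : ℂ) * I) := by
    unfold torusPhase
    have hsum : (∑ i : Fin 2, (k i).val * ((Pi.single j (1 : ZMod L) : TorusSite 2 L) i).val : ℕ) = (k j).val := by
      rw [Fin.sum_univ_two]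
      fin_cases j <;> simp [ZMod.val_one]
    rw [hsum]
    congr 1
    push_cast
    ring
  rw [torusPhase_add_right, hstep, ← mul_one_sub, norm_mul, norm_torusPhase, one_mul]
  set θ : ℝ := 2 * Real.pi * ((k j).val : ℝ) / (L : ℝ) with hθ
  rw [← Complex.normSq_eq_norm_sq]
  rw [show (1 : ℂ) - cexp ((θ : ℂ) * I) = ⟨1 - Real.cos θ, -Real.sin θ⟩ from by
    apply Complex.ext <;> simp [Complex.exp_ofReal_mul_I_re, Complex.exp_ofReal_mul_I_im]]
  rw [Complex.normSq_mk]
  nlinarith [Real.sin_sq_add_cos_sq θ]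

/-! ## The bond ↔ edge bijection for `L ≥ 3` -/

/-- Every edge of the torus is a directed bond `{x, x+eⱼ}` (surjectivity; with `bond_injective` the directed
bonds enumerate the edges exactly once for `L ≥ 3`). [folklore] -/
theorem edgeFinset_eq_image_bonds (hL : 3 ≤ L) :
    (torusGraph 2 L).edgeFinset
      = (Finset.univ : Finset (TorusSite 2 L × Fin 2)).image
          fun p => (s(p.1, p.1 + Pi.single p.2 1) : Sym2 (TorusSite 2 L)) := by
  classical
  ext e
  rw [Finset.mem_image]
  constructor
  · intro he
    induction e using Sym2.ind with
    | h a b =>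
      rw [SimpleGraph.mem_edgeFinset, SimpleGraph.mem_edgeSet, torusGraph_adj_iff] at he
      obtain ⟨_, h | h⟩ := he
      · obtain ⟨i, hi⟩ := h
        exact ⟨(a, i), Finset.mem_univ _, by rw [hi]⟩
      · obtain ⟨i, hi⟩ := h
        exact ⟨(b, i), Finset.mem_univ _, by rw [hi, Sym2.eq_swap]⟩
  · rintro ⟨p, -, rfl⟩
    exact bond_mem_edgeFinset (by omega) p.1 p.2

/-- **Edge sums are directed-bond sums** (`L ≥ 3`). [folklore] -/
theorem sum_edge_eq_sum_bond (hL : 3 ≤ L) {β : Type*} [AddCommMonoid β] (g : Sym2 (TorusSite 2 L) → β) :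
    ∑ e ∈ (torusGraph 2 L).edgeFinset, g e = ∑ p : TorusSite 2 L × Fin 2, g s(p.1, p.1 + Pi.single p.2 1) := by
  classical
  rw [edgeFinset_eq_image_bonds hL, Finset.sum_image (fun p _ q _ h => bond_injective hL h)]

/-! ## The lattice f-sum rule -/

/-- **THE LATTICE f-SUM RULE** (stub T-FSUM of THEOREM TWIST-IR; theory seat memo ROTOR-THEORY-8 §118), `L ≥ 3`:
for a real eigen-amplitude `ψ` of `H = xxzHamiltonian 1 (torusGraph 2 L) (−1) Δ` (`Hψ = Eψ`) and every grid
momentum `k`, with `D_k = Hρ_k − ρ_kH` and the eigenbasis `(vᵢ, λᵢ)` of `H`: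
`Σᵢ |⟨vᵢ, D_kψ⟩|²/(λᵢ − E) = Σ_j (1 − cos(2πk_j/L)) · Re⟨ψ, (−T_j)ψ⟩`. [folklore] -/
theorem latticeFSum_eq (hL : 3 ≤ L) (Δ : ℝ) (a : TensorIndex (TorusSite 2 L) 2 → ℝ) (E : ℝ)
    (ha : hcbHamiltonian L Δ *ᵥ toC L a = (E : ℂ) • toC L a) (k : TorusSite 2 L) :
    ∑ i, ‖star (⇑((xxzHamiltonian_isHermitian 1 (torusGraph 2 L) (-1) Δ).eigenvectorBasis i))
          ⬝ᵥ (currentDiv L Δ k *ᵥ toC L a)‖ ^ 2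
        / ((xxzHamiltonian_isHermitian 1 (torusGraph 2 L) (-1) Δ).eigenvalues i - E)
      = ∑ j : Fin 2, (1 - Real.cos (2 * Real.pi * ((k j).val : ℝ) / (L : ℝ)))
          * (star (toC L a) ⬝ᵥ (kineticOp L j *ᵥ toC L a)).re := by
  set hH := xxzHamiltonian_isHermitian 1 (torusGraph 2 L) (-1) Δ
  -- `D_k ψ = (H − E)(ρ_k ψ)`
  set φ : TensorIndex (TorusSite 2 L) 2 → ℂ := densityModeOp L k *ᵥ toC L a with hφ
  have hD : currentDiv L Δ k *ᵥ toC L a = hcbHamiltonian L Δ *ᵥ φ - (E : ℂ) • φ := by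
    unfold currentDiv
    rw [hφ]
    exact comm_mulVec_eigen _ _ _ _ ha
  rw [hD, spectral_fsum (hcbHamiltonian L Δ) hH E φ]
  -- ground-state transform with `u = ρ_k`
  have hφu : ∀ σ, φ σ = (∑ s, if σ s = 0 then torusPhase L k s else 0) * (a σ : ℂ) := by
    intro σ; rw [hφ]; unfold densityModeOp toC; rw [mulVec_diagonal]
  have hshift : hcbHamiltonian L Δ *ᵥ φ - (E : ℂ) • φ
      = (hcbHamiltonian L Δ - ((E : ℝ) : ℂ) • (1 : Op (TorusSite 2 L) 2)) *ᵥ φ := by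
    rw [Matrix.sub_mulVec, Matrix.smul_mulVec, Matrix.one_mulVec]
  have ha' : (xxzHamiltonian 1 (torusGraph 2 L) (-1) Δ : Op (TorusSite 2 L) 2) *ᵥ (fun σ => (a σ : ℂ))
      = (E : ℂ) • fun σ => (a σ : ℂ) := ha
  rw [hshift, shiftedForm_re,
    xxz_groundStateTransform (torusGraph 2 L) Δ a E ha' (fun σ => ∑ s, if σ s = 0 then torusPhase L k s else 0)
      φ hφu,
    sum_edge_eq_sum_bond hL]
  simp only [Sym2.lift_mk]
  -- the right-hand side as a directed-bond sum
  have hR : ∑ j : Fin 2, (1 - Real.cos (2 * Real.pi * ((k j).val : ℝ) / (L : ℝ)))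
        * (star (toC L a) ⬝ᵥ (kineticOp L j *ᵥ toC L a)).re
      = ∑ p : TorusSite 2 L × Fin 2, (1 - Real.cos (2 * Real.pi * ((k p.2).val : ℝ) / (L : ℝ)))
          * (star (toC L a) ⬝ᵥ ((spinBond 1 0 p.1 (p.1 + Pi.single p.2 1)
              + spinBond 1 1 p.1 (p.1 + Pi.single p.2 1) : Op (TorusSite 2 L) 2) *ᵥ toC L a)).re := by
    rw [Fintype.sum_prod_type_right]
    refine Finset.sum_congr rfl fun j _ => ?_
    rw [kineticForm_sum, Complex.re_sum, Finset.mul_sum]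
  rw [hR]
  refine Finset.sum_congr rfl fun p _ => ?_
  obtain ⟨x, j⟩ := p
  have hxy : x ≠ x + Pi.single j 1 := Ne.symm (add_single_ne_self (by omega) x j)
  -- per bond: `¼ Σ_flip aa'|Δρ_k|² = ¼ · 2(1−cos) · 2 Re⟨ψ,Kψ⟩`
  unfold toC
  rw [kineticBondForm_eq hxy a, Finset.mul_sum, Finset.mul_sum]
  refine Finset.sum_congr rfl fun σ _ => ?_
  split_ifs with hflip
  · rw [norm_densityMode_sub_comp_swap hxy σ hflip k, norm_torusPhase_sub_sq (by omega) k x j]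
    ring
  · simp

end Summit.HubbardSuperconductivity.HubbardSuperconductivity.Theorems.AnisotropyChord.Stiffness
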